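import Summits.CriticalPhenomena.PercolationContinuityZ3.Theorems.PercNearOneGluingNoHeavyLowerTailSunflowerBlowup
import Summits.CriticalPhenomena.PercolationContinuityZ3.Theorems.PercNearOneGluingNoHeavyLowerTailSunflowerBernsteinPentagon
import Mathlib.Combinatorics.SimpleGraph.CycleGraph
import HarnessLib

/-!
# `NoHeavyLowerTail` (crux stmt-CriticalPhenomena-4575), abstract sunflower cubic: EVERY BLOW-UP OF THE PENTAGON IS A-SAFE

Support file (seat `prim-ineq-prove-1` gen 42; `--supports stmt-CriticalPhenomena-4575`; `--computational` because the pentagon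
certificate `Pentagon.safe_core` of `…SunflowerBernsteinPentagon` (gen 38) rests on compiled Bernstein-coefficient checks).  No `sorry`,
no named facts.  Memo: run/shared/lean/prim/prim-ineq-prove-1/FINDING-BLOWUP-prove1-g42.md §2.

`edgeCore_cycleGraph_five`: the graph core of Mathlib's `cycleGraph 5` is the pentagon core `Pentagon.core`; with the blow-up theorem
`aSafe_edgeCore_comap` (`…SunflowerBlowup`):
**`safe_edgeCore_of_pentagon_blowup`** — if `Γ.Adj u v ↔ (cycleGraph 5).Adj (f u) (f v)` for some `f : ι → Fin 5` (i.e. `Γ` is the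
5-cycle with every vertex replaced by a possibly empty independent class of twins, consecutive classes completely joined), then
`Safe p (edgeCore Γ)` for EVERY `p` — Lemma A for every number of petals and every product measure, hence (g34 `…_of_safe`) the
(C1-law), `H/G/T`, `GW_k` and Kahn-5 rows.  The first infinite family of NON-bipartite triangle-free graphs for which `TriangleFreeSafe`
is a theorem; with Häggkvist's theorem (triangle-free with minimum degree `> 3n/8` ⟹ homomorphic to `C₅`) it contains every MAXIMAL
triangle-free graph of minimum degree `> 3n/8`.
-/

noncomputable section

namespace Summit.CriticalPhenomena.PercolationContinuityZ3.Theorems.SunflowerPartition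

namespace SafeCalc

open Finset

variable {ι : Type*} [Fintype ι]

/-! ## Blow-ups of the pentagon -/

/-- The graph core of Mathlib's 5-cycle `cycleGraph 5` is the pentagon core `Pentagon.core` of `…SunflowerBernsteinPentagon`.
[this work] -/
theorem edgeCore_cycleGraph_five : edgeCore (SimpleGraph.cycleGraph 5) = Pentagon.core := by
  ext ω
  constructor
  · rintro ⟨u, v, huv, hu, hv⟩
    have key : ∀ u v : Fin 5, (SimpleGraph.cycleGraph 5).Adj u v → ∃ j, Pentagon.G j ⊆ {u, v} := by decide
    obtain ⟨j, hj⟩ := key u v huv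
    refine ⟨j, fun w hw => ?_⟩
    have hw' : w ∈ ({u, v} : Finset (Fin 5)) := hj (Finset.mem_coe.1 hw)
    rcases Finset.mem_insert.1 hw' with rfl | hw''
    · exact hu
    · rw [Finset.mem_singleton.1 hw'']
      exact hv
  · rintro ⟨j, hj⟩
    have key : ∀ j : Fin 5, ∃ u v : Fin 5, (SimpleGraph.cycleGraph 5).Adj u v ∧ u ∈ Pentagon.G j ∧ v ∈ Pentagon.G j := by
      decide
    obtain ⟨u, v, huv, hu, hv⟩ := key j
    exact ⟨u, v, huv, hj (Finset.mem_coe.2 hu), hj (Finset.mem_coe.2 hv)⟩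

/-- **Every blow-up of the pentagon is A-safe**: for every `f : ι → Fin 5` (classes `f ⁻¹ i`, possibly empty) and every `p`, the
graph core of `(cycleGraph 5).comap f` (`u ~ v` iff `f u`, `f v` are adjacent on the 5-cycle) is safe. [this work] -/
theorem safe_edgeCore_pentagon_comap (f : ι → Fin 5) (p : ι → unitInterval) :
    Safe p (edgeCore ((SimpleGraph.cycleGraph 5).comap f)) :=
  aSafe_edgeCore_comap f _ (fun q => by rw [edgeCore_cycleGraph_five]; exact Pentagon.safe_core q) p

/-- **Blow-ups of the pentagon, intrinsic form**: if `Γ.Adj u v ↔ f u ~ f v` on the 5-cycle for some `f : ι → Fin 5` (i.e. `Γ` is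
`C₅` with each vertex replaced by a — possibly empty — independent set of twins), then the graph core of `Γ` is A-safe.  The first
infinite family of NON-bipartite triangle-free graphs for which `TriangleFreeSafe` is a theorem. [this work] -/
theorem safe_edgeCore_of_pentagon_blowup (Γ : SimpleGraph ι) (f : ι → Fin 5)
    (hΓ : ∀ u v, Γ.Adj u v ↔ (SimpleGraph.cycleGraph 5).Adj (f u) (f v)) (p : ι → unitInterval) :
    Safe p (edgeCore Γ) := by
  have h : (SimpleGraph.cycleGraph 5).comap f = Γ := by
    ext u v
    exact (hΓ u v).symm
  rw [← h]
  exact safe_edgeCore_pentagon_comap f p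

end SafeCalc

end Summit.CriticalPhenomena.PercolationContinuityZ3.Theorems.SunflowerPartition
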